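import Summits.HodgeConjecture.CorCM.HypDel.M1primeOfFUPart1   -- E-FU part 1

/-!
# M1′ from (F) and (U) — E-FU PART 4 of 7 (+ HEAD `M1primeOfFU`): 
§ 7 — W3 ASSEMBLY v3 (B-p11 g10): the H-texts and `stubW3_of_leaves`

Cell hodgecm-mathlib, rung 0 of the Mumford line under `HDel` (item `stmt-HodgeConjecture-24835`).  The E-FU text proves
`deligne1971_siegelModuliOnPoints` (M1′ = [Deligne 1971, 4.16–4.21 on points]) as a THEOREM of the two finer printed facts
(F) `lan2013_siegelFineModuliScheme` [Lan 2013, Thm. 1.4.1.11 + Cor. 7.2.3.9] and (U) `siegelModuli_complexUniformisation`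
[MFK94 App. 7A; Deligne 1971, 4.12–4.21; Milne 2005 Thm. 6.11]; it is split into a chain of part files only because of the
400-line cap on proof-bearing `Summits/` files (B-plan1 R22, director s96).  The composition and `theorem M1prime_of_F_U` live in
the HEAD file `Summits/HodgeConjecture/CorCM/HypDel/M1primeOfFU.lean`; provenance of every § is kept in its banner below and in
HOME `B-plan/lines/m1prime/M1primeOfFU.skeleton.md`.  This part does NOT depend on (F)/(U).
HC_CM is proved only modulo the 7 printed citations until rung 0 closes.
-/

universe u   -- was declared inside the dropped D1 paste
open CategoryTheory CategoryTheory.Limits AlgebraicGeometry MonoidalCategory   -- was a TOP-LEVEL `open` of the dropped D1 paste (and of (M)); the pasted (F)/(U)/partC/§§ rely on it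

/-! ═══════════════════════════════════════════════════════════════════════════════════════════════════════════════════
# § 7 — W3-ASSEMBLY v3 (B-p11 g10 — `stub_W3` ASSEMBLER per B-plan1 R11/R12/R13b/P41)
(closer-§ provenance and fold history: HOME `B-plan/lines/m1prime/M1primeOfFU.skeleton.md` + the by-import twin editions.) -/

noncomputable section

namespace Summit.HodgeConjecture.CorCM.HypDel.M1primeOfFU

open CategoryTheory CategoryTheory.Limits AlgebraicGeometry
open Literature.AlgebraicGeometry
open Literature.AlgebraicGeometry.Motives (specOver AlgPoints AbelianVariety CartierDivisor)
open Literature.AlgebraicGeometry.AbelianSchemes (PolarizedAbelianSchemeWithLevel)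
open Literature.AlgebraicGeometry.ModuliOfAbelianVarieties

/-- The transfer clause of ★ `SiegelRationalModel.IsModuli` (:305) for a `σ`-semilinear map `φ : A^σ ⟶ A′` and two
markings `(μ, μ′)`: «`φ(σ·μ(v)) = μ′(w)` whenever `k a⁻¹ v ≡ a′⁻¹ w (mod ẑ)`». [cite: Milne2005ShimuraVarieties, §14 (63) p. 116 and Prop. 14.12 p. 125] -/
def ConjHomCompat {g : ℕ} {δ : Fin g → ℕ} (σ : ℂ ≃ₐ[ℚ] ℂ) (k a a' : gspFinAdelic δ) {J J' : C0pm δ}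
    {A A' : AbelianVariety ℂ} (μ : SiegelAdelicMarking J a A) (μ' : SiegelAdelicMarking J' a' A')
    (φ : A.conjugate σ.toRingEquiv ⟶ A') : Prop :=
  ∀ v w : Fin g ⊕ Fin g → ℚ,
    AdelicCongr ((k * a⁻¹ : gspFinAdelic δ) : GL (Fin g ⊕ Fin g) finAdeleQ)
        ((a'⁻¹ : gspFinAdelic δ) : GL (Fin g ⊕ Fin g) finAdeleQ) v w →
      AlgPoints.map φ.hom.hom.hom (A.conjPoints σ.toRingEquiv (μ.r v)) = μ'.r w

/-- The three clauses of `MarkedBy J a P′` for GIVEN data `(m, Θ, Λ)` (so the assembly can hand the witnesses to the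
leaves): `MarkedBy J a P′ ↔ ∃ m Θ Λ, MarkedByWith J a P′ m Θ Λ` definitionally. [cite: Milne2005ShimuraVarieties, §6 Thm. 6.11 p. 74] -/
def MarkedByWith {g N : ℕ} {δ : Fin g → ℕ} (J : C0pm δ) (a : gspFinAdelic δ)
    (P' : PolarizedAbelianSchemeWithLevel g N δ (specOver ℚ ℂ).left)
    (m : SiegelAdelicMarking J a (P'.A.fibre (𝟙 (Spec (CommRingCat.of ℂ)))).toAbelianVariety)
    (Θ : CartierDivisor (P'.A.fibre (𝟙 (Spec (CommRingCat.of ℂ)))).toAbelianVariety.X.left)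
    (Λ : P'.level.SymplecticLift (𝟙 (Spec (CommRingCat.of ℂ))) Θ δ) : Prop :=
  Θ.IsAmple ∧ P'.A.IsLambdaOfAt (𝟙 (Spec (CommRingCat.of ℂ))) P'.D P'.pol.lam Θ ∧
    ∀ ⦃M : ℕ⦄, N ∣ M → M ≠ 0 → ∀ (x : Fin g ⊕ Fin g → ZMod M) (v : Fin g ⊕ Fin g → ℚ),
      AdelicCongr ((a⁻¹ : gspFinAdelic δ) : GL (Fin g ⊕ Fin g) finAdeleQ) 1 v (fun i => ((x i).val : ℚ) / M) →
        ((Λ.lift M (Multiplicative.ofAdd x)) :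
          (P'.A.fibre (𝟙 (Spec (CommRingCat.of ℂ)))).toAbelianVariety.Points ℂ) = m.r v

/-- **The TYPE of σ-junction readings** — the currency in which H1 tells H3's λ-half how the fibre junction `jσ` and the
witness divisors `Θ₁` (on `P′`) / `Θσ` (on the re-base `Pσ`) are related (e.g. «`ē^{Θσ}_M(P, Q) = ē^{Θ₁^σ}_M(jσ P, jσ Q)`»,
or «`Θσ = jσ^*Θ₁^σ`», or «`jσ` is `G` on the fibre»).  The assembly is PARAMETRIC in it: producer (D-BC∃ assembler) and
consumer ((c-iii)) agree on the predicate; nothing here depends on its content. [cite: Milne2005ShimuraVarieties, §14 p. 124 («σ(A, s, ηK) = (σA, σs, σηK)»)] -/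
abbrev SigmaReading (g N : ℕ) (δ : Fin g → ℕ) : Type 1 :=
  ∀ (σ : ℂ ≃ₐ[ℚ] ℂ) (P' Pσ : PolarizedAbelianSchemeWithLevel g N δ (specOver ℚ ℂ).left)
    (G : Pσ.A.X.left ⟶ P'.A.X.left) (Ĝ : Pσ.D.hat.X.left ⟶ P'.D.hat.X.left)
    (jσ : (Pσ.A.fibre (𝟙 (Spec (CommRingCat.of ℂ)))).toAbelianVariety ≅
      ((P'.A.fibre (𝟙 (Spec (CommRingCat.of ℂ)))).toAbelianVariety).conjugate σ.toRingEquiv)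
    (Θ₁ : CartierDivisor (P'.A.fibre (𝟙 (Spec (CommRingCat.of ℂ)))).toAbelianVariety.X.left)
    (Θσ : CartierDivisor (Pσ.A.fibre (𝟙 (Spec (CommRingCat.of ℂ)))).toAbelianVariety.X.left), Prop

/-- **`hpair` — THE σ-READING OF RECORD (B-plan1 P41, (R-a) PAIRING CURRENCY)**: «`ē^{Θσ}_M (jσ⁻¹ P^σ) (jσ⁻¹ Q^σ) =
σ (ē^{Θ₁}_M P Q)` for all `N ∣ M`, `(M : ℂ) ≠ 0`», in ★ `weilPairingLevel` currency and READING form (no point is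
constructed: whenever `jσ` carries `M`-torsion points `Pt, Qt` of the re-based fibre to `P^σ, Q^σ`); the `[M]`-dominance
instances are supplied in-line by ★ `isDominant_toSchemeHom_zsmul_of_ne_zero`.  H1 exports it (B-p13: `Θσ := Θ₁` base-changed,
★ `weilPairingLevel_conjugate` + ★ `weilPairingLevel_pullback_eq`), H3's λ half consumes it (B-p21 `htower` → B-p03 (G5)).
[cite: Milne2005ShimuraVarieties, §14 p. 124 («σ(A, s, ηK) = (σA, σs, σηK)»)] [cite: Shimura1998, §18.6 proof (p. 130)] -/
def HPair (g N : ℕ) (δ : Fin g → ℕ) : SigmaReading g N δ :=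
  fun σ P' Pσ _ _ jσ Θ₁ Θσ =>
    ∀ ⦃M : ℕ⦄, N ∣ M → ∀ (hM : (M : ℂ) ≠ 0),
      haveI := AbelianVariety.isDominant_toSchemeHom_zsmul_of_ne_zero
        (Pσ.A.fibre (𝟙 (Spec (CommRingCat.of ℂ)))).toAbelianVariety hM
      haveI := AbelianVariety.isDominant_toSchemeHom_zsmul_of_ne_zero
        (P'.A.fibre (𝟙 (Spec (CommRingCat.of ℂ)))).toAbelianVariety hM
      ∀ (P Q : ((P'.A.fibre (𝟙 (Spec (CommRingCat.of ℂ)))).toAbelianVariety).torsionPoints ℂ M)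
        (Pt Qt : ((Pσ.A.fibre (𝟙 (Spec (CommRingCat.of ℂ)))).toAbelianVariety).torsionPoints ℂ M),
        AlgPoints.map jσ.hom.hom.hom.hom Pt.1 =
          ((P'.A.fibre (𝟙 (Spec (CommRingCat.of ℂ)))).toAbelianVariety).conjPoints σ.toRingEquiv P.1 →
        AlgPoints.map jσ.hom.hom.hom.hom Qt.1 =
          ((P'.A.fibre (𝟙 (Spec (CommRingCat.of ℂ)))).toAbelianVariety).conjPoints σ.toRingEquiv Q.1 →
        ((Pσ.A.fibre (𝟙 (Spec (CommRingCat.of ℂ)))).toAbelianVariety).weilPairingLevel Θσ Pt Qt =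
          σ (((P'.A.fibre (𝟙 (Spec (CommRingCat.of ℂ)))).toAbelianVariety).weilPairingLevel Θ₁ P Q)

/-- **H1 — D-BC∃ along `Spec σ` with the fibre-junction exports and the σ-reading `PR`** (landing shape for B-p13's
assembly): for every `σ ∈ Aut(ℂ/ℚ)` and every triple `P′` over `Spec ℂ` carrying an ample `IsLambdaOfAt` witness `Θ₁`,
there are a re-base `Pσ` of `P′` along `Spec σ` (D4 `IsBaseChangeVia`), a fibre iso `jσ : fibre(Pσ) ≅ fibre(P′)^σ` which
reads `conjPoints σ` on the level sections, an ample `IsLambdaOfAt` witness `Θσ` on `Pσ`, AND the reading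
`PR σ P′ Pσ G Ĝ jσ Θ₁ Θσ`. [cite: Milne2005ShimuraVarieties, §14 p. 124 («σ(A, s, ηK) = (σA, σs, σηK)»)] [cite: MumfordFogartyKirwan1994, Ch. 7 §2 Definition 7.2 (p. 129)] -/
def DBCSigmaExport (PR : ∀ g N δ, SigmaReading g N δ) (g N : ℕ) (δ : Fin g → ℕ) : Prop :=
  ∀ (σ : ℂ ≃ₐ[ℚ] ℂ) (P' : PolarizedAbelianSchemeWithLevel g N δ (specOver ℚ ℂ).left)
    (Θ₁ : CartierDivisor (P'.A.fibre (𝟙 (Spec (CommRingCat.of ℂ)))).toAbelianVariety.X.left),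
    Θ₁.IsAmple → P'.A.IsLambdaOfAt (𝟙 (Spec (CommRingCat.of ℂ))) P'.D P'.pol.lam Θ₁ →
    ∃ (Pσ : PolarizedAbelianSchemeWithLevel g N δ (specOver ℚ ℂ).left)
      (G : Pσ.A.X.left ⟶ P'.A.X.left) (Ĝ : Pσ.D.hat.X.left ⟶ P'.D.hat.X.left)
      (jσ : (Pσ.A.fibre (𝟙 (Spec (CommRingCat.of ℂ)))).toAbelianVariety ≅
        ((P'.A.fibre (𝟙 (Spec (CommRingCat.of ℂ)))).toAbelianVariety).conjugate σ.toRingEquiv)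
      (Θσ : CartierDivisor (Pσ.A.fibre (𝟙 (Spec (CommRingCat.of ℂ)))).toAbelianVariety.X.left),
      Pσ.IsBaseChangeVia P' (AlgPoints.specMap σ).left G Ĝ ∧
      (∀ i, AlgPoints.map jσ.hom.hom.hom.hom (Pσ.A.restrictPt (𝟙 (Spec (CommRingCat.of ℂ))) (Pσ.level.σ i)) =
        ((P'.A.fibre (𝟙 (Spec (CommRingCat.of ℂ)))).toAbelianVariety).conjPoints σ.toRingEquiv
          (P'.A.restrictPt (𝟙 (Spec (CommRingCat.of ℂ))) (P'.level.σ i))) ∧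
      Θσ.IsAmple ∧ Pσ.A.IsLambdaOfAt (𝟙 (Spec (CommRingCat.of ℂ))) Pσ.D Pσ.pol.lam Θσ ∧
      PR g N δ σ P' Pσ G Ĝ jσ Θ₁ Θσ

/-- **H2 — transfer of the `IsModuli` datum along the row-J isomorphisms** (landing shape for B-p21's (W3-J); CLOSED by
`markedConjHomTransfer` below): the `σ`-semilinear `f : A^σ ⟶ A′` compatible with the markings `(m, m′)` yields
`f_B : B^σ ⟶ B′` compatible with any markings `(μ, μ′)` of the same classes. [cite: Milne2005ShimuraVarieties, §6 Thm. 6.11 p. 74 and §14 (63) p. 116] -/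
def MarkedConjHomTransfer (g : ℕ) (δ : Fin g → ℕ) : Prop :=
  ∀ (σ : ℂ ≃ₐ[ℚ] ℂ) (J J' : C0pm δ) (a a' k : gspFinAdelic δ) (A A' B B' : AbelianVariety ℂ)
    (m : SiegelAdelicMarking J a A) (m' : SiegelAdelicMarking J' a' A') (μ : SiegelAdelicMarking J a B)
    (μ' : SiegelAdelicMarking J' a' B') (f : A.conjugate σ.toRingEquiv ⟶ A'),
    ConjHomCompat σ k a a' m m' f → ∃ f_B : B.conjugate σ.toRingEquiv ⟶ B', ConjHomCompat σ k a a' μ μ' f_B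

/-- **H3 — W3c, TRIPLE TRANSPORT ALONG `𝟙 (Spec ℂ)`** (landing shape; SPLIT below into K1/K2/K3): under `StubW3`'s
ambient hypotheses, given the σ-re-base `Pσ` of `P′` with its exports (H1's outputs, including the reading `PR`), the
`MarkedBy` data of `P′` (by `(J, a)`) and of `P″` (by `(J′, a′)`), `k ∈ K_δ(N)` and the transferred
`f_B : fibre(P′)^σ ⟶ fibre(P″)` compatible with the two markings, the triples `Pσ` and `P″` are related along `𝟙`.
[cite: Milne2005ShimuraVarieties, §14 Prop. 14.12 p. 125, §6 Thm. 6.11 p. 74]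
[cite: MumfordFogartyKirwan1994, Ch. 6 §1 Cor. 6.4–6.6 (p. 117), Ch. 7 §2 Def. 7.2 (p. 129)] -/
def TripleTransportAlongId (PR : ∀ g N δ, SigmaReading g N δ) (g N : ℕ) (δ : Fin g → ℕ) : Prop :=
  0 < g → IsPolarizationType δ → 3 ≤ N →
  ∀ (σ : ℂ ≃ₐ[ℚ] ℂ) (J J' : C0pm δ) (a a' k : gspFinAdelic δ), k ∈ principalLevelSubgroup δ N →
    ∀ (P' Pσ P'' : PolarizedAbelianSchemeWithLevel g N δ (specOver ℚ ℂ).left)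
      (G : Pσ.A.X.left ⟶ P'.A.X.left) (Ĝ : Pσ.D.hat.X.left ⟶ P'.D.hat.X.left),
      Pσ.IsBaseChangeVia P' (AlgPoints.specMap σ).left G Ĝ →
    ∀ (jσ : (Pσ.A.fibre (𝟙 (Spec (CommRingCat.of ℂ)))).toAbelianVariety ≅
        ((P'.A.fibre (𝟙 (Spec (CommRingCat.of ℂ)))).toAbelianVariety).conjugate σ.toRingEquiv),
      (∀ i, AlgPoints.map jσ.hom.hom.hom.hom (Pσ.A.restrictPt (𝟙 (Spec (CommRingCat.of ℂ))) (Pσ.level.σ i)) =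
        ((P'.A.fibre (𝟙 (Spec (CommRingCat.of ℂ)))).toAbelianVariety).conjPoints σ.toRingEquiv
          (P'.A.restrictPt (𝟙 (Spec (CommRingCat.of ℂ))) (P'.level.σ i))) →
    ∀ (Θσ : CartierDivisor (Pσ.A.fibre (𝟙 (Spec (CommRingCat.of ℂ)))).toAbelianVariety.X.left),
      Θσ.IsAmple → Pσ.A.IsLambdaOfAt (𝟙 (Spec (CommRingCat.of ℂ))) Pσ.D Pσ.pol.lam Θσ →
    ∀ (m₁ : SiegelAdelicMarking J a (P'.A.fibre (𝟙 (Spec (CommRingCat.of ℂ)))).toAbelianVariety)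
      (Θ₁ : CartierDivisor (P'.A.fibre (𝟙 (Spec (CommRingCat.of ℂ)))).toAbelianVariety.X.left)
      (Λ₁ : P'.level.SymplecticLift (𝟙 (Spec (CommRingCat.of ℂ))) Θ₁ δ), MarkedByWith J a P' m₁ Θ₁ Λ₁ →
      PR g N δ σ P' Pσ G Ĝ jσ Θ₁ Θσ →
    ∀ (m₂ : SiegelAdelicMarking J' a' (P''.A.fibre (𝟙 (Spec (CommRingCat.of ℂ)))).toAbelianVariety)
      (Θ₂ : CartierDivisor (P''.A.fibre (𝟙 (Spec (CommRingCat.of ℂ)))).toAbelianVariety.X.left)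
      (Λ₂ : P''.level.SymplecticLift (𝟙 (Spec (CommRingCat.of ℂ))) Θ₂ δ), MarkedByWith J' a' P'' m₂ Θ₂ Λ₂ →
    ∀ (f_B : ((P'.A.fibre (𝟙 (Spec (CommRingCat.of ℂ)))).toAbelianVariety).conjugate σ.toRingEquiv ⟶
        (P''.A.fibre (𝟙 (Spec (CommRingCat.of ℂ)))).toAbelianVariety),
      ConjHomCompat σ k a a' m₁ m₂ f_B →
    ∃ (H : Pσ.A.X.left ⟶ P''.A.X.left) (Ĥ : Pσ.D.hat.X.left ⟶ P''.D.hat.X.left),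
      Pσ.IsBaseChangeVia P'' (𝟙 (specOver ℚ ℂ) : specOver ℚ ℂ ⟶ specOver ℚ ℂ).left H Ĥ

/-- **THE W3 ASSEMBLY (v3): `StubW3` from H1, H2, H3**, parametric in the σ-reading `PR` — B-p13's junction (1)(2)(3):
destructure the `IsModuli` datum and the two `MarkedBy`s, re-base along `Spec σ` (H1), transfer `f` to the fibres (H2),
transport the triple (H3), and read both steps on classifying maps by ★ D4 (M) `classifyingMap_comp`
(`σ • x = specMap σ ≫ x`). [cite: Milne2005ShimuraVarieties, §14 Prop. 14.12 p. 125] [cite: Deligne1971TravauxShimura, 4.16–4.17 p. 150] -/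
theorem stubW3_of_leaves (PR : ∀ g N δ, SigmaReading g N δ) (H1 : ∀ g N δ, DBCSigmaExport PR g N δ)
    (H2 : ∀ g (δ : Fin g → ℕ), MarkedConjHomTransfer g δ) (H3 : ∀ g N δ, TripleTransportAlongId PR g N δ) :
    (∀ (g N : ℕ) (δ : Fin g → ℕ), StubW3 g N δ) := by
  intro g N δ hg hδ hN 𝓜 σ J J' a a' A A' m m' f hf P' P'' hP' hP''
  obtain ⟨k, hk, hfk⟩ := hf
  obtain ⟨m₁, Θ₁, Λ₁, h₁a, h₁l, h₁t⟩ := hP'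
  obtain ⟨m₂, Θ₂, Λ₂, h₂a, h₂l, h₂t⟩ := hP''
  obtain ⟨Pσ, G, Ĝ, jσ, Θσ, hσ, hjσ, hΘa, hΘl, hPR⟩ := H1 g N δ σ P' Θ₁ h₁a h₁l
  obtain ⟨fB, hfB⟩ := H2 g δ σ J J' a a' k A A' _ _ m m' m₁ m₂ f hfk
  obtain ⟨H, Ĥ, hc⟩ := H3 g N δ hg hδ hN σ J J' a a' k hk P' Pσ P'' G Ĝ hσ jσ hjσ Θσ hΘa hΘl m₁ Θ₁ Λ₁
    ⟨h₁a, h₁l, h₁t⟩ hPR m₂ Θ₂ Λ₂ ⟨h₂a, h₂l, h₂t⟩ fB hfB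
  haveI : IsLocallyNoetherian (specOver ℚ ℂ).left :=
    inferInstanceAs (IsLocallyNoetherian (Spec (CommRingCat.of ℂ)))
  have e1 := 𝓜.classifyingMap_comp (AlgPoints.specMap σ) P' Pσ hσ
  have e2 := 𝓜.classifyingMap_comp (𝟙 (specOver ℚ ℂ)) P'' Pσ hc
  rw [Category.id_comp] at e2
  rw [AlgPoints.smul_def, e1, e2]

/-- **H2 DISCHARGED** by ★ (W3-J) §4 `SiegelAdelicMarking.exists_hom_conjugate_forall_adelicCongr_of_forall` (B-p21 g11,
p684655 + p685056): the fixed-`k` transfer of the `IsModuli` datum along the row-J isomorphisms.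
[cite: Milne2005ShimuraVarieties, §6 Thm. 6.11 p. 74 and §14 pp. 124–125] -/
theorem markedConjHomTransfer (g : ℕ) (δ : Fin g → ℕ) : MarkedConjHomTransfer g δ :=
  fun σ _ _ _ _ k _ _ _ _ m m' μ μ' f hf =>
    SiegelAdelicMarking.exists_hom_conjugate_forall_adelicCongr_of_forall σ k m μ m' μ' f hf

/-- **`StubW3` modulo H1 and H3** (H2 discharged). [cite: Milne2005ShimuraVarieties, §14 Prop. 14.12 p. 125] -/
theorem stubW3_of_H1_H3 (PR : ∀ g N δ, SigmaReading g N δ) (H1 : ∀ g N δ, DBCSigmaExport PR g N δ)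
    (H3 : ∀ g N δ, TripleTransportAlongId PR g N δ) : (∀ (g N : ℕ) (δ : Fin g → ℕ), StubW3 g N δ) :=
  stubW3_of_leaves PR H1 markedConjHomTransfer H3

/-! ## H3 SPLIT (B-plan1 R13b): X+LEVEL half `K1` ⊕ HAT/Poincaré half `K2` ⊕ λ half `K3` -/

/-- «The scheme map `H = e.hom.left : Xσ → X″` READS the fibre iso `h` on the identity fibres»:
`h ≫ pr = pr ≫ H` on `Xσ ×_S S → X″` (the junction the λ-half needs to see `h = jσ ≫ f_B` inside `H`).
[cite: MumfordFogartyKirwan1994, Ch. 7 §2 Definition 7.3 (p. 130)] -/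
def FibreReads {g N : ℕ} {δ : Fin g → ℕ} (Pσ P'' : PolarizedAbelianSchemeWithLevel g N δ (specOver ℚ ℂ).left)
    (e : Pσ.A.X ≅ P''.A.X)
    (h : (Pσ.A.fibre (𝟙 (Spec (CommRingCat.of ℂ)))).toAbelianVariety ≅
      (P''.A.fibre (𝟙 (Spec (CommRingCat.of ℂ)))).toAbelianVariety) : Prop :=
  h.hom.hom.hom.hom.left ≫ pullback.fst P''.A.X.hom (𝟙 (Spec (CommRingCat.of ℂ))) =
    pullback.fst Pσ.A.X.hom (𝟙 (Spec (CommRingCat.of ℂ))) ≫ e.hom.left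

/-- **K1 — the X+LEVEL half** (landing shape; ★ p682042 `levelStructure_isBaseChangeVia_id_of_fibreIso` ∘ ★ p684288
`map_restrictPt_level_eq_of_conj_of_hom_eq`; R13b: B-p21): from the two `MarkedByWith` data, the junction `jσ` reading
`(·)^σ` on level sections, `f_B` compatible with the markings for `k ∈ K_δ(N)` (`N ≠ 0`) and a fibre iso `h` with
`h = jσ ≫ f_B`: an isomorphism of `Spec ℂ`-GROUP schemes `e : Xσ ≅ X″` reading `h` on the fibres, along which the LEVEL
clause of D4 `IsBaseChangeVia` holds along `𝟙`. [cite: MumfordFogartyKirwan1994, Ch. 7 §2 Definition 7.3 (p. 130)]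
[cite: Milne2005ShimuraVarieties, §6 Thm. 6.11 p. 74 and p. 75] -/
def FibreLevelTransport (g N : ℕ) (δ : Fin g → ℕ) : Prop :=
  ∀ (σ : ℂ ≃ₐ[ℚ] ℂ) (J J' : C0pm δ) (a a' k : gspFinAdelic δ), k ∈ principalLevelSubgroup δ N → N ≠ 0 →
    ∀ (P' Pσ P'' : PolarizedAbelianSchemeWithLevel g N δ (specOver ℚ ℂ).left)
      (jσ : (Pσ.A.fibre (𝟙 (Spec (CommRingCat.of ℂ)))).toAbelianVariety ≅
        ((P'.A.fibre (𝟙 (Spec (CommRingCat.of ℂ)))).toAbelianVariety).conjugate σ.toRingEquiv),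
      (∀ i, AlgPoints.map jσ.hom.hom.hom.hom (Pσ.A.restrictPt (𝟙 (Spec (CommRingCat.of ℂ))) (Pσ.level.σ i)) =
        ((P'.A.fibre (𝟙 (Spec (CommRingCat.of ℂ)))).toAbelianVariety).conjPoints σ.toRingEquiv
          (P'.A.restrictPt (𝟙 (Spec (CommRingCat.of ℂ))) (P'.level.σ i))) →
    ∀ (m₁ : SiegelAdelicMarking J a (P'.A.fibre (𝟙 (Spec (CommRingCat.of ℂ)))).toAbelianVariety)
      (Θ₁ : CartierDivisor (P'.A.fibre (𝟙 (Spec (CommRingCat.of ℂ)))).toAbelianVariety.X.left)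
      (Λ₁ : P'.level.SymplecticLift (𝟙 (Spec (CommRingCat.of ℂ))) Θ₁ δ), MarkedByWith J a P' m₁ Θ₁ Λ₁ →
    ∀ (m₂ : SiegelAdelicMarking J' a' (P''.A.fibre (𝟙 (Spec (CommRingCat.of ℂ)))).toAbelianVariety)
      (Θ₂ : CartierDivisor (P''.A.fibre (𝟙 (Spec (CommRingCat.of ℂ)))).toAbelianVariety.X.left)
      (Λ₂ : P''.level.SymplecticLift (𝟙 (Spec (CommRingCat.of ℂ))) Θ₂ δ), MarkedByWith J' a' P'' m₂ Θ₂ Λ₂ →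
    ∀ (f_B : ((P'.A.fibre (𝟙 (Spec (CommRingCat.of ℂ)))).toAbelianVariety).conjugate σ.toRingEquiv ⟶
        (P''.A.fibre (𝟙 (Spec (CommRingCat.of ℂ)))).toAbelianVariety),
      ConjHomCompat σ k a a' m₁ m₂ f_B →
    ∀ (h : (Pσ.A.fibre (𝟙 (Spec (CommRingCat.of ℂ)))).toAbelianVariety ≅
        (P''.A.fibre (𝟙 (Spec (CommRingCat.of ℂ)))).toAbelianVariety), h.hom = jσ.hom ≫ f_B →
    ∃ e : Pσ.A.X ≅ P''.A.X, IsMonHom e.hom ∧ FibreReads Pσ P'' e h ∧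
      Pσ.level.IsBaseChangeVia P''.level (𝟙 (specOver ℚ ℂ) : specOver ℚ ℂ ⟶ specOver ℚ ℂ).left e.hom.left

/-- **K2 — the HAT / Poincaré half** (landing shape for B-p01's (c-ii-H) `AbelianSchemeDualTransport` 83b889cc:
`Ĥ := hatTransport P″.D Pσ.D e`, `hat_isBaseChangeVia_id_hatTransport`, `nonempty_pullback_map_hatTransport_iso`, with
`TrivialAtUnit` from the two `IsLambdaOfAt` witnesses by `trivialAtUnit_of_isLambdaOfAt`): for an isomorphism of
`Spec ℂ`-group schemes `e : Xσ ≅ X″` between POLARISED abelian schemes, a dual transport `Ĥ : X̂σ → X̂″` along which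
the HAT clause and the POINCARÉ clause of D4 `IsBaseChangeVia` hold along `𝟙`.
[cite: MilneAV2008, I §8 pp. 36–37] [cite: MumfordFogartyKirwan1994, Ch. 7 §2 Definition 7.3 (p. 130)] -/
def HatPoincareTransport (g N : ℕ) (δ : Fin g → ℕ) : Prop :=
  ∀ (Pσ P'' : PolarizedAbelianSchemeWithLevel g N δ (specOver ℚ ℂ).left)
    (Θσ : CartierDivisor (Pσ.A.fibre (𝟙 (Spec (CommRingCat.of ℂ)))).toAbelianVariety.X.left),
    Pσ.A.IsLambdaOfAt (𝟙 (Spec (CommRingCat.of ℂ))) Pσ.D Pσ.pol.lam Θσ →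
    ∀ (Θ₂ : CartierDivisor (P''.A.fibre (𝟙 (Spec (CommRingCat.of ℂ)))).toAbelianVariety.X.left),
    P''.A.IsLambdaOfAt (𝟙 (Spec (CommRingCat.of ℂ))) P''.D P''.pol.lam Θ₂ →
    ∀ (e : Pσ.A.X ≅ P''.A.X), IsMonHom e.hom →
    ∃ Ĥ : Pσ.D.hat.X.left ⟶ P''.D.hat.X.left,
      Pσ.D.hat.IsBaseChangeVia P''.D.hat (𝟙 (specOver ℚ ℂ) : specOver ℚ ℂ ⟶ specOver ℚ ℂ).left Ĥ ∧
      ∃ (wG : Pσ.A.X.hom ≫ (𝟙 (specOver ℚ ℂ) : specOver ℚ ℂ ⟶ specOver ℚ ℂ).left = e.hom.left ≫ P''.A.X.hom)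
        (wĜ : Pσ.D.hat.X.hom ≫ (𝟙 (specOver ℚ ℂ) : specOver ℚ ℂ ⟶ specOver ℚ ℂ).left = Ĥ ≫ P''.D.hat.X.hom),
        Nonempty ((Scheme.Modules.pullback
          (pullback.map Pσ.A.X.hom Pσ.D.hat.X.hom P''.A.X.hom P''.D.hat.X.hom e.hom.left Ĥ
            (𝟙 (specOver ℚ ℂ) : specOver ℚ ℂ ⟶ specOver ℚ ℂ).left wG wĜ)).obj P''.D.P ≅ Pσ.D.P)

/-- **K3 — the λ half** (landing shape for B-p03's (c-iii) assembly (G5) over (S1)+(G1)+(G4)+(A3)): given ALL of H3's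
data (including the σ-reading `PR`), the fibre iso `h = jσ ≫ f_B`, the group-scheme iso `e` READING `h` with its level
clause (K1's outputs) and a dual transport `Ĥ` with its hat and Poincaré clauses (K2's outputs), the λ-CLAUSE
`λσ ≫ Ĥ = H ≫ λ″` of D4 `IsBaseChangeVia` holds. [cite: Milne2005ShimuraVarieties, §14 Prop. 14.12 p. 125]
[cite: MumfordFogartyKirwan1994, Ch. 6 §1 Cor. 6.4–6.6 (p. 117), Ch. 7 §2 Definition 7.3 (p. 130)] -/
def LamClauseTransport (PR : ∀ g N δ, SigmaReading g N δ) (g N : ℕ) (δ : Fin g → ℕ) : Prop :=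
  0 < g → IsPolarizationType δ → 3 ≤ N →
  ∀ (σ : ℂ ≃ₐ[ℚ] ℂ) (J J' : C0pm δ) (a a' k : gspFinAdelic δ), k ∈ principalLevelSubgroup δ N →
    ∀ (P' Pσ P'' : PolarizedAbelianSchemeWithLevel g N δ (specOver ℚ ℂ).left)
      (G : Pσ.A.X.left ⟶ P'.A.X.left) (Ĝ : Pσ.D.hat.X.left ⟶ P'.D.hat.X.left),
      Pσ.IsBaseChangeVia P' (AlgPoints.specMap σ).left G Ĝ →
    ∀ (jσ : (Pσ.A.fibre (𝟙 (Spec (CommRingCat.of ℂ)))).toAbelianVariety ≅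
        ((P'.A.fibre (𝟙 (Spec (CommRingCat.of ℂ)))).toAbelianVariety).conjugate σ.toRingEquiv),
      (∀ i, AlgPoints.map jσ.hom.hom.hom.hom (Pσ.A.restrictPt (𝟙 (Spec (CommRingCat.of ℂ))) (Pσ.level.σ i)) =
        ((P'.A.fibre (𝟙 (Spec (CommRingCat.of ℂ)))).toAbelianVariety).conjPoints σ.toRingEquiv
          (P'.A.restrictPt (𝟙 (Spec (CommRingCat.of ℂ))) (P'.level.σ i))) →
    ∀ (Θσ : CartierDivisor (Pσ.A.fibre (𝟙 (Spec (CommRingCat.of ℂ)))).toAbelianVariety.X.left),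
      Θσ.IsAmple → Pσ.A.IsLambdaOfAt (𝟙 (Spec (CommRingCat.of ℂ))) Pσ.D Pσ.pol.lam Θσ →
    ∀ (m₁ : SiegelAdelicMarking J a (P'.A.fibre (𝟙 (Spec (CommRingCat.of ℂ)))).toAbelianVariety)
      (Θ₁ : CartierDivisor (P'.A.fibre (𝟙 (Spec (CommRingCat.of ℂ)))).toAbelianVariety.X.left)
      (Λ₁ : P'.level.SymplecticLift (𝟙 (Spec (CommRingCat.of ℂ))) Θ₁ δ), MarkedByWith J a P' m₁ Θ₁ Λ₁ →
      PR g N δ σ P' Pσ G Ĝ jσ Θ₁ Θσ →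
    ∀ (m₂ : SiegelAdelicMarking J' a' (P''.A.fibre (𝟙 (Spec (CommRingCat.of ℂ)))).toAbelianVariety)
      (Θ₂ : CartierDivisor (P''.A.fibre (𝟙 (Spec (CommRingCat.of ℂ)))).toAbelianVariety.X.left)
      (Λ₂ : P''.level.SymplecticLift (𝟙 (Spec (CommRingCat.of ℂ))) Θ₂ δ), MarkedByWith J' a' P'' m₂ Θ₂ Λ₂ →
    ∀ (f_B : ((P'.A.fibre (𝟙 (Spec (CommRingCat.of ℂ)))).toAbelianVariety).conjugate σ.toRingEquiv ⟶
        (P''.A.fibre (𝟙 (Spec (CommRingCat.of ℂ)))).toAbelianVariety),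
      ConjHomCompat σ k a a' m₁ m₂ f_B →
    ∀ (h : (Pσ.A.fibre (𝟙 (Spec (CommRingCat.of ℂ)))).toAbelianVariety ≅
        (P''.A.fibre (𝟙 (Spec (CommRingCat.of ℂ)))).toAbelianVariety), h.hom = jσ.hom ≫ f_B →
    ∀ (e : Pσ.A.X ≅ P''.A.X), IsMonHom e.hom → FibreReads Pσ P'' e h →
      Pσ.level.IsBaseChangeVia P''.level (𝟙 (specOver ℚ ℂ) : specOver ℚ ℂ ⟶ specOver ℚ ℂ).left e.hom.left →
    ∀ (Ĥ : Pσ.D.hat.X.left ⟶ P''.D.hat.X.left),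
      Pσ.D.hat.IsBaseChangeVia P''.D.hat (𝟙 (specOver ℚ ℂ) : specOver ℚ ℂ ⟶ specOver ℚ ℂ).left Ĥ →
    ∀ (wG : Pσ.A.X.hom ≫ (𝟙 (specOver ℚ ℂ) : specOver ℚ ℂ ⟶ specOver ℚ ℂ).left = e.hom.left ≫ P''.A.X.hom)
      (wĜ : Pσ.D.hat.X.hom ≫ (𝟙 (specOver ℚ ℂ) : specOver ℚ ℂ ⟶ specOver ℚ ℂ).left = Ĥ ≫ P''.D.hat.X.hom),
      Nonempty ((Scheme.Modules.pullback
        (pullback.map Pσ.A.X.hom Pσ.D.hat.X.hom P''.A.X.hom P''.D.hat.X.hom e.hom.left Ĥ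
          (𝟙 (specOver ℚ ℂ) : specOver ℚ ℂ ⟶ specOver ℚ ℂ).left wG wĜ)).obj P''.D.P ≅ Pσ.D.P) →
    Pσ.pol.lam.left ≫ Ĥ = e.hom.left ≫ P''.pol.lam.left

/-- **H3 FROM ITS THREE HALVES** (R13b): `k ∈ K_δ(N) ≤ K_δ(1)` makes `f_B` an isomorphism (★ R60-57b
`isIso_of_forall_adelicCongr`), `h := jσ ≪≫ asIso f_B`; K1 gives `(e, level clause)`, K2 gives `(Ĥ, hat + Poincaré
clauses)`, K3 the λ-clause; the four conjuncts are D4 `IsBaseChangeVia` along `𝟙`. [cite: MumfordFogartyKirwan1994, Ch. 7 §2 Definition 7.3 (p. 130)]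
[cite: Milne2005ShimuraVarieties, §14 Prop. 14.12 p. 125] -/
theorem tripleTransportAlongId_of_halves (PR : ∀ g N δ, SigmaReading g N δ)
    (K1 : ∀ g N δ, FibreLevelTransport g N δ) (K2 : ∀ g N δ, HatPoincareTransport g N δ)
    (K3 : ∀ g N δ, LamClauseTransport PR g N δ) (g N : ℕ) (δ : Fin g → ℕ) :
    TripleTransportAlongId PR g N δ := by
  intro hg hδ hN σ J J' a a' k hk P' Pσ P'' G Ĝ hσ jσ hjσ Θσ hΘa hΘl m₁ Θ₁ Λ₁ h₁ hPR m₂ Θ₂ Λ₂ h₂ fB hfB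
  have hN0 : N ≠ 0 := by omega
  have hk1 : k ∈ principalLevelSubgroup δ 1 := principalLevelSubgroup_anti δ (one_dvd N) hk
  haveI : IsIso fB := SiegelAdelicMarking.isIso_of_forall_adelicCongr m₁ m₂ σ fB hk1 hfB
  obtain ⟨e, hem, her, hel⟩ := K1 g N δ σ J J' a a' k hk hN0 P' Pσ P'' jσ hjσ m₁ Θ₁ Λ₁ h₁ m₂ Θ₂ Λ₂ h₂ fB hfB
    (jσ ≪≫ asIso fB) rfl
  obtain ⟨Ĥ, hhat, wG, wĜ, hP⟩ := K2 g N δ Pσ P'' Θσ hΘl Θ₂ h₂.2.1 e hem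
  exact ⟨e.hom.left, Ĥ, hel, hhat, ⟨wG, wĜ, hP⟩,
    K3 g N δ hg hδ hN σ J J' a a' k hk P' Pσ P'' G Ĝ hσ jσ hjσ Θσ hΘa hΘl m₁ Θ₁ Λ₁ h₁ hPR m₂ Θ₂ Λ₂ h₂ fB hfB
      (jσ ≪≫ asIso fB) rfl e hem her hel Ĥ hhat wG wĜ hP⟩

/-- **`StubW3` modulo H1 and the three halves of H3.** [cite: Milne2005ShimuraVarieties, §14 Prop. 14.12 p. 125] -/
theorem stubW3_of_H1_K (PR : ∀ g N δ, SigmaReading g N δ) (H1 : ∀ g N δ, DBCSigmaExport PR g N δ)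
    (K1 : ∀ g N δ, FibreLevelTransport g N δ) (K2 : ∀ g N δ, HatPoincareTransport g N δ)
    (K3 : ∀ g N δ, LamClauseTransport PR g N δ) : (∀ (g N : ℕ) (δ : Fin g → ℕ), StubW3 g N δ) :=
  stubW3_of_H1_H3 PR H1 (tripleTransportAlongId_of_halves PR K1 K2 K3)

/-! ## THE TEXTS OF RECORD (P41): H1 = `DBCSigmaExport HPair`, H3 = `TripleTransportAlongId HPair`,
λ half = `LamClauseTransport HPair`; the parametric forms above exist so that a later change of reading currency never
touches the assembly again. -/

/-- **H1 of record** (P41): D-BC∃ along `Spec σ` with the junction exports AND `hpair`. [cite: Milne2005ShimuraVarieties, §14 p. 124] -/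
abbrev DBCSigmaExportR (g N : ℕ) (δ : Fin g → ℕ) : Prop := DBCSigmaExport HPair g N δ

/-- **λ half of record** (P41): `LamClauseTransport HPair`. [cite: Milne2005ShimuraVarieties, §14 Prop. 14.12 p. 125] -/
abbrev LamClauseTransportR (g N : ℕ) (δ : Fin g → ℕ) : Prop := LamClauseTransport HPair g N δ

end Summit.HodgeConjecture.CorCM.HypDel.M1primeOfFU

end
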